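import Literature.Topology.FourManifolds.TrisectionsHandleBoxes
import HarnessLib

/-!
# The top height `T` of the Morse-theoretic trisection: definition and smoothness

Topic `Literature/Topology/FourManifolds`; step E3c (part ii) of a Morse-theoretic construction
of Gay–Kirby's trisection for the fact seat
`provefact-Literature.Topology.FourManifolds.exists_isBalancedGKTrisection` (Gay–Kirby 2016,
Thm. 4 via §4, Lemma 14).  Everything in this file is **proved**; the definitions are explicit.

With `s = f - a` the height above the Heegaard level `Y = f⁻¹(a)`, the three sectors of the
trisection are `X₁ = {s ≤ 0, 2s ≤ T}`, `X₂ = {0 ≤ s ≤ T}`, `X₃ = {s ≥ T, 2s ≥ T}` for one smooth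
function `T : X → ℝ`, the **top height**, built here from a system of `2`-handle boxes
`H : HandleBoxes f ξ a η ι` (`TrisectionsHandleBoxes.lean`) and a Heegaard function `φ` on `Y`:

* `HandleBoxes.topRaw` — on the band: `h₂(φ̄)` (`φ̄ = flowLift φ`, extended by `S_max` across the
  non-hitting set, `satLift`), overridden on the switch sets `{P_j < P_sw}` by `T_P(P_j)`; the two
  recipes agree (`= S_max`) near the switch boundary because `T_P = S_max` on `[2P₁, ∞)`,
  `h₂ = S_max` on `(-∞, v₁]` and `φ̄ ≤ v₁` there (`HandleBoxes.flowLift_le_of_P_lt`);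
  `HandleBoxes.contMDiffAt_topRaw` — smooth on the band `a - η < f < a + 2η`;
  `topRaw = T_P ∘ P_j` on the switch sets, `= h₂(φ̄)` at hitting points off them;
* `HandleBoxes.topHeight` — the global top height
  `T = χ_lo(s) χ_hi(s) · T_raw + (1 - χ_lo(s)) S_max - (1 - χ_hi(s)) S_min`, smooth on `X`
  (`HandleBoxes.contMDiff_topHeight`) when `χ_lo χ_hi` is supported in the band.

## References

* D. Gay, R. Kirby, *Trisecting 4-manifolds*, Geom. Topol. 20 (2016), §4, Lemma 14 and proof of
  Thm. 4. [GayKirby2016]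
* J. Milnor, *Lectures on the h-cobordism theorem* (1965), Def. 3.1, Thm. 3.12, Thm. 4.1. [MilnorHCobordism1965]
-/

open scoped Manifold ContDiff Topology
open Set Function Filter Metric

noncomputable section

universe u

namespace Literature.Topology.FourManifolds

open Flow

/-- Local notation: `𝔼 n` is the model Euclidean space `EuclideanSpace ℝ (Fin n)`. -/
local notation "𝔼 " n:arg => EuclideanSpace ℝ (Fin n)

variable {X : Type u} [TopologicalSpace X] [T2Space X] [CompactSpace X] [ChartedSpace (𝔼 4) X]
  [IsManifold (𝓡 4) ∞ X]
  {f : X → ℝ} {ξ : Π x : X, TangentSpace (𝓡 4) x} {a η : ℝ} {ι : Type} [Fintype ι]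

namespace HandleBoxes

variable (H : HandleBoxes f ξ a η ι)

/-! ### The raw top height on the band -/

/-- **The raw top height**: `h₂(φ̄)` (saturated by `S_max` across the non-hitting set), replaced
by `T_P(P_j)` on the switch sets. [cite: GayKirby2016, §4, Lemma 14] -/
def topRaw (hξ : ContMDiff (𝓡 4) (𝓡 4).tangent ∞ fun x => (⟨x, ξ x⟩ : TangentBundle (𝓡 4) X))
    (h : IsRegularLevel (𝓡 4) f a) (φ : RegularLevel h → ℝ) (h₂ TP : ℝ → ℝ) (Smax Psw : ℝ) (z : X) : ℝ :=
  satLift hξ h φ h₂ Smax z +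
    ∑ j, (H.swSet Psw j).indicator (fun w => TP (H.P j w) - satLift hξ h φ h₂ Smax w) z

variable {hξ : ContMDiff (𝓡 4) (𝓡 4).tangent ∞ fun x => (⟨x, ξ x⟩ : TangentBundle (𝓡 4) X)}
  {h : IsRegularLevel (𝓡 4) f a} {φ : RegularLevel h → ℝ} {h₂ TP : ℝ → ℝ} {Smax Psw : ℝ}

/-- **On the switch set `S_j`, `T_raw = T_P(P_j)`.** [cite: GayKirby2016, §4, Lemma 14] -/
theorem topRaw_of_mem_swSet {j : ι} {z : X} (hz : z ∈ H.swSet Psw j) :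
    H.topRaw hξ h φ h₂ TP Smax Psw z = TP (H.P j z) := by
  unfold topRaw
  rw [Finset.sum_eq_single j]
  · rw [indicator_of_mem hz]; ring
  · intro i _ hij
    rw [indicator_of_notMem]
    exact fun hi => (H.swSet_disjoint Psw hij).le_bot ⟨hi, hz⟩
  · intro hj; exact absurd (Finset.mem_univ j) hj

/-- **Off the switch sets, `T_raw = satLift h₂`** (`= h₂(φ̄)` at hitting points). [cite: GayKirby2016, §4, Lemma 14] -/
theorem topRaw_of_forall_not_mem {z : X} (hz : ∀ j, z ∉ H.swSet Psw j) :
    H.topRaw hξ h φ h₂ TP Smax Psw z = satLift hξ h φ h₂ Smax z := by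
  unfold topRaw
  rw [Finset.sum_eq_zero fun j _ => indicator_of_notMem (hz j) _, add_zero]

/-- Off the switch sets at a hitting point, `T_raw = h₂(φ̄)`. [cite: GayKirby2016, §4, Lemma 14] -/
theorem topRaw_of_forall_not_mem_of_hits {z : X} (hz : ∀ j, z ∉ H.swSet Psw j) (hh : Hits (flowθ hξ) f a z) :
    H.topRaw hξ h φ h₂ TP Smax Psw z = h₂ (flowLift hξ h φ z) := by
  rw [H.topRaw_of_forall_not_mem hz, satLift_of_hits hh]

/-- **`T_raw ≡ S_max` near the switch boundary.**  On `source_j ∩ {2P₁ < P_j < 2P_sw}` inside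
the band, `T_raw = S_max` (given `T_P = S_max` on `[2P₁, ∞)`, `h₂ = S_max` on `(-∞, v₁]`, and
`φ ≤ v₁` on `{P_j < 2P_sw} ∩ Y ∩ source_j`). [cite: GayKirby2016, §4, Lemma 14] -/
theorem topRaw_eq_of_mem_collar (hgl : IsGradientLike (𝓡 4) f ξ) (hfM : IsMorse (𝓡 4) f)
    {P₁ v₁ : ℝ} (hPsw : 2 * Psw ≤ η ^ 2) (hTP₂ : ∀ P, 2 * P₁ ≤ P → TP P = Smax)
    (hh₂v : ∀ t ≤ v₁, h₂ t = Smax)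
    (hφv : ∀ j (y : RegularLevel h), y.1 ∈ (H.box j).chart.source → H.P j y.1 < 2 * Psw → φ y ≤ v₁)
    {j : ι} {w : X} (hwsrc : w ∈ (H.box j).chart.source) (hP₁ : 2 * P₁ < H.P j w) (hP₂ : H.P j w < 2 * Psw)
    (hf₁ : a - η < f w) (hf₂ : f w < a + 2 * η) :
    H.topRaw hξ h φ h₂ TP Smax Psw w = Smax := by
  by_cases hsw : w ∈ H.swSet Psw j
  · rw [H.topRaw_of_mem_swSet hsw]; exact hTP₂ _ hP₁.le
  · have hall : ∀ i, w ∉ H.swSet Psw i := by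
      intro i hi
      by_cases hij : i = j
      · subst hij; exact hsw hi
      · exact (H.disjoint hij).le_bot ⟨hi.1, hwsrc⟩
    rw [H.topRaw_of_forall_not_mem hall]
    exact satLift_eq_of_forall_le hh₂v fun hh =>
      H.flowLift_le_of_P_lt hgl hfM hPsw (hφv j) hwsrc hP₂ hf₁ hf₂ hh

/-- **The raw top height is smooth on the band** `a - η < f < a + 2η`. [cite: GayKirby2016, §4, Lemma 14] -/
theorem contMDiffAt_topRaw (hgl : IsGradientLike (𝓡 4) f ξ) (hfM : IsMorse (𝓡 4) f)
    (hφ : ContMDiff (𝓡 3) 𝓘(ℝ, ℝ) ∞ φ) (hh₂ : ContDiff ℝ ∞ h₂) (hTP : ContDiff ℝ ∞ TP)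
    {P₁ v₁ : ℝ} (hPsw0 : 0 < Psw) (hPsw : 2 * Psw ≤ η ^ 2) (hP₁ : 2 * P₁ < Psw)
    (hTP₂ : ∀ P, 2 * P₁ ≤ P → TP P = Smax) (hh₂v : ∀ t ≤ v₁, h₂ t = Smax)
    (hφv : ∀ j (y : RegularLevel h), y.1 ∈ (H.box j).chart.source → H.P j y.1 < 2 * Psw → φ y ≤ v₁)
    {z : X} (hf₁ : a - η < f z) (hf₂ : f z < a + 2 * η) :
    ContMDiffAt (𝓡 4) 𝓘(ℝ, ℝ) ∞ (H.topRaw hξ h φ h₂ TP Smax Psw) z := by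
  have hη := H.eta_pos
  have hcontf : Continuous f := hfM.contMDiff.continuous
  have hband : ∀ᶠ w in 𝓝 z, a - η < f w ∧ f w < a + 2 * η :=
    (hcontf.continuousAt.eventually (Ioo_mem_nhds hf₁ hf₂)).mono fun w hw => hw
  by_cases h1 : ∃ j, z ∈ H.swSet Psw j
  · -- Case 1: inside a switch set, `T_raw = T_P ∘ P_j`
    obtain ⟨j, hz⟩ := h1
    have hev : H.topRaw hξ h φ h₂ TP Smax Psw =ᶠ[𝓝 z] fun w => TP (H.P j w) := by
      filter_upwards [(H.isOpen_swSet Psw j).mem_nhds hz] with w hw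
      exact H.topRaw_of_mem_swSet hw
    refine ContMDiffAt.congr_of_eventuallyEq ?_ hev
    exact (hTP.contMDiff.contMDiffAt).comp z (H.contMDiffAt_P hz.1)
  · push Not at h1
    by_cases h2 : ∃ j, z ∈ (H.box j).chart.source ∧ H.P j z < 2 * Psw
    · -- Case 2a: in the collar of the switch boundary, `T_raw ≡ S_max` nearby
      obtain ⟨j, hzsrc, hzP⟩ := h2
      have hzP' : Psw ≤ H.P j z := by
        by_contra hlt; push Not at hlt; exact h1 j ⟨hzsrc, hlt⟩
      have hcP : ContinuousAt (H.P j) z :=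
        (H.continuousOn_P j).continuousAt ((H.box j).chart.open_source.mem_nhds hzsrc)
      have hev : H.topRaw hξ h φ h₂ TP Smax Psw =ᶠ[𝓝 z] fun _ => Smax := by
        filter_upwards [(H.box j).chart.open_source.mem_nhds hzsrc,
          hcP.eventually (Ioo_mem_nhds (show 2 * P₁ < H.P j z by linarith) hzP), hband] with w hw hwP hwf
        exact H.topRaw_eq_of_mem_collar hgl hfM hPsw hTP₂ hh₂v hφv hw hwP.1 hwP.2 hwf.1 hwf.2
      exact contMDiffAt_const.congr_of_eventuallyEq hev
    · -- Case 2b: away from the switch sets, `T_raw = satLift h₂` near the hitting point `z`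
      push Not at h2
      have hhit : Hits (flowθ hξ) f a z := by
        by_contra hh
        obtain ⟨j, hj, -⟩ := H.exists_mem_swSet_of_not_hits (hξ := hξ) hgl hfM hPsw0 hf₁ hf₂ hh
        exact h1 j hj
      have hev1 : ∀ i, ∀ᶠ w in 𝓝 z, w ∉ H.swSet Psw i := by
        intro i
        by_cases hi : z ∈ (H.box i).chart.source
        · have hcP : ContinuousAt (H.P i) z :=
            (H.continuousOn_P i).continuousAt ((H.box i).chart.open_source.mem_nhds hi)
          have hge : Psw < H.P i z := by linarith [h2 i hi]
          filter_upwards [hcP.eventually (Ioi_mem_nhds hge)] with w hw hwS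
          exact absurd hwS.2 (not_lt.2 (le_of_lt hw))
        · exact H.eventually_not_mem_swSet_of_not_mem_source (by nlinarith) hcontf hi hf₁ hf₂
      have hev : H.topRaw hξ h φ h₂ TP Smax Psw =ᶠ[𝓝 z] satLift hξ h φ h₂ Smax := by
        filter_upwards [Filter.eventually_all.2 hev1] with w hw
        exact H.topRaw_of_forall_not_mem hw
      refine ContMDiffAt.congr_of_eventuallyEq ?_ hev
      exact contMDiffAt_satLift_of_hits hgl hfM hφ hh₂ Smax hhit

/-! ### The global top height -/

/-- **The top height** `T = χ_lo(s) χ_hi(s) T_raw + (1 - χ_lo(s)) S_max - (1 - χ_hi(s)) S_min`,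
`s = f - a`. [cite: GayKirby2016, §4, Lemma 14] -/
def topHeight (hξ : ContMDiff (𝓡 4) (𝓡 4).tangent ∞ fun x => (⟨x, ξ x⟩ : TangentBundle (𝓡 4) X))
    (h : IsRegularLevel (𝓡 4) f a) (φ : RegularLevel h → ℝ) (h₂ TP χlo χhi : ℝ → ℝ)
    (Smax Smin Psw : ℝ) (z : X) : ℝ :=
  χlo (f z - a) * χhi (f z - a) * H.topRaw hξ h φ h₂ TP Smax Psw z +
    (1 - χlo (f z - a)) * Smax - (1 - χhi (f z - a)) * Smin

variable {χlo χhi : ℝ → ℝ} {Smin : ℝ}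

/-- The top height as a height cut-off plus two functions of `f`. [folklore] -/
theorem topHeight_eq (z : X) :
    H.topHeight hξ h φ h₂ TP χlo χhi Smax Smin Psw z =
      heightCut f a (fun s => χlo s * χhi s) (H.topRaw hξ h φ h₂ TP Smax Psw) 0 z +
        ((1 - χlo (f z - a)) * Smax - (1 - χhi (f z - a)) * Smin) := by
  simp only [topHeight, heightCut, sub_zero, add_zero]
  ring

/-- **In the band (`χ_lo = χ_hi = 1`), `T = T_raw`.** [folklore] -/
theorem topHeight_of_eq_one {z : X} (hlo : χlo (f z - a) = 1) (hhi : χhi (f z - a) = 1) :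
    H.topHeight hξ h φ h₂ TP χlo χhi Smax Smin Psw z = H.topRaw hξ h φ h₂ TP Smax Psw z := by
  simp [topHeight, hlo, hhi]

/-- **Below the band (`χ_lo = 0`, `χ_hi = 1`), `T = S_max`.** [folklore] -/
theorem topHeight_of_lo {z : X} (hlo : χlo (f z - a) = 0) (hhi : χhi (f z - a) = 1) :
    H.topHeight hξ h φ h₂ TP χlo χhi Smax Smin Psw z = Smax := by
  simp [topHeight, hlo, hhi]

/-- **Above the band (`χ_lo = 1`, `χ_hi = 0`), `T = -S_min`.** [folklore] -/
theorem topHeight_of_hi {z : X} (hlo : χlo (f z - a) = 1) (hhi : χhi (f z - a) = 0) :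
    H.topHeight hξ h φ h₂ TP χlo χhi Smax Smin Psw z = -Smin := by
  simp [topHeight, hlo, hhi]

/-- **The top height is smooth on `X`** when `χ_lo χ_hi` is supported in the band `(-η, 2η)`
(and under the hypotheses of `contMDiffAt_topRaw`). [cite: GayKirby2016, §4, Lemma 14] -/
theorem contMDiff_topHeight (hgl : IsGradientLike (𝓡 4) f ξ) (hfM : IsMorse (𝓡 4) f)
    (hφ : ContMDiff (𝓡 3) 𝓘(ℝ, ℝ) ∞ φ) (hh₂ : ContDiff ℝ ∞ h₂) (hTP : ContDiff ℝ ∞ TP)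
    (hχlo : ContDiff ℝ ∞ χlo) (hχhi : ContDiff ℝ ∞ χhi)
    (hsupp : tsupport (fun s => χlo s * χhi s) ⊆ Ioo (-η) (2 * η))
    {P₁ v₁ : ℝ} (hPsw0 : 0 < Psw) (hPsw : 2 * Psw ≤ η ^ 2) (hP₁ : 2 * P₁ < Psw)
    (hTP₂ : ∀ P, 2 * P₁ ≤ P → TP P = Smax) (hh₂v : ∀ t ≤ v₁, h₂ t = Smax)
    (hφv : ∀ j (y : RegularLevel h), y.1 ∈ (H.box j).chart.source → H.P j y.1 < 2 * Psw → φ y ≤ v₁) :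
    ContMDiff (𝓡 4) 𝓘(ℝ, ℝ) ∞ (H.topHeight hξ h φ h₂ TP χlo χhi Smax Smin Psw) := by
  have hf : ContMDiff (𝓡 4) 𝓘(ℝ, ℝ) ∞ f := hfM.contMDiff
  have hcut : ContMDiff (𝓡 4) 𝓘(ℝ, ℝ) ∞
      (heightCut f a (fun s => χlo s * χhi s) (H.topRaw hξ h φ h₂ TP Smax Psw) 0) := by
    refine contMDiff_heightCut (hχlo.mul hχhi) hf 0 fun z hz => ?_
    have hz' := hsupp hz
    exact H.contMDiffAt_topRaw hgl hfM hφ hh₂ hTP hPsw0 hPsw hP₁ hTP₂ hh₂v hφv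
      (by linarith [hz'.1]) (by linarith [hz'.2])
  have hrest : ContMDiff (𝓡 4) 𝓘(ℝ, ℝ) ∞ fun z =>
      (1 - χlo (f z - a)) * Smax - (1 - χhi (f z - a)) * Smin := by
    have hs : ContMDiff (𝓡 4) 𝓘(ℝ, ℝ) ∞ fun z => f z - a := hf.sub contMDiff_const
    exact ((contMDiff_const.sub (hχlo.contMDiff.comp hs)).mul contMDiff_const).sub
      ((contMDiff_const.sub (hχhi.contMDiff.comp hs)).mul contMDiff_const)
  have heq : H.topHeight hξ h φ h₂ TP χlo χhi Smax Smin Psw = fun z =>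
      heightCut f a (fun s => χlo s * χhi s) (H.topRaw hξ h φ h₂ TP Smax Psw) 0 z +
        ((1 - χlo (f z - a)) * Smax - (1 - χhi (f z - a)) * Smin) := funext (H.topHeight_eq)
  rw [heq]
  exact hcut.add hrest

end HandleBoxes

end Literature.Topology.FourManifolds

end
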